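import Literature.Claims.NS.Dou2026c
import Literature.Analysis.FluidPDE.PolynomialFieldCertificates
import Mathlib.MeasureTheory.Measure.Lebesgue.VolumeOfBalls
import HarnessLib

/-!
# C54 `Dou2026c` — refutation certificates, part (α): the base flow itself (`v₀ = 0`)

Text of record: Hua-Shu Dou, «Disproving the Existence of Global Smooth Solutions to the
Three-Dimensional Navier–Stokes Equations for Plane Poiseuille Flow», Preprints.org 202509.1747 v3
(2026), PDF pages. Skeleton `Literature.Claims.NS.Dou2026c` rev 2 (typist-3 g2, p484616):
`claim_of_steps Recr : Step1_vanishingPoint Recr → Step2_thm31 → Step3_16to21 → Step4_positivity →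
ClaimedTheorem Recr`. This part is typist-3 g2's kill kit v3 §(A) (claims/Dou2026c/typist3-killkit,
sha16 851d6344799c15e9), adopted by the refuter of record (refuter-3) with one rename
(`not_ClaimedTheorem` → `not_ClaimedTheorem_baseFlow`); part (β) — the referee's charitable reading
`v₀ ≠ 0` (Poiseuille + decaying Stokes mode) — is `SoloRefuteDou2026cHeatMode.lean`.

Kernel facts, all at the PRINTED class (pressure-driven, bounded, no-slip on both walls — no Couette):
the paper's own base flow is a global smooth solution of the typed channel problem, and the printed
hypotheses admit the zero disturbance `v₀ = 0` —

* `poiseuille_isChannelSolution : Step0_baseFlow` (§2.1 PDF p.5: Poiseuille + `p = −Gx` solves the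
  unforced equations in the slab with no-slip walls, pressure-driven with gradient `G`, bounded by
  `G h²/(2ν)` — polynomial calculus via the tree's `PolynomialFieldCertificates` bridge);
* `zero_admissible` (`v₀ = 0` is an admissible «small disturbance» as printed/typed);
* `not_Step1_vanishingPoint : ∀ Recr, ¬ Step1_vanishingPoint Recr` — §4.2 Step 1 (2)–(3) with (20),
  PDF p.12, is false for the base flow (`ΔU₀ ≡ −(G/ν) e_x`, so the local H¹-energy of `Δu` on any
  interior ball is a positive constant, not tending to `0`);
* `not_ClaimedTheorem_baseFlow : ∀ Recr, ¬ ClaimedTheorem Recr`, `not_ClaimedTheoremE` — Theorem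
  4.1's operative clause («no global smooth solutions», PDF p.10) is false as printed/typed: for
  `ν = h = 1`, `G = 2(|Recr| + 1)` (so `Re > Recr`) and `v₀ = 0`, the steady Poiseuille flow is a
  global smooth solution.

WHAT THIS IS NOT: not a claim about NS regularity or blow-up; not a claim about any author beyond the
typed locator.
-/

noncomputable section

open Set Filter MeasureTheory
open scoped Topology Laplacian InnerProductSpace ContDiff

-- the cell's Theorems namespace repeats the summit name (convention); silence the duplicate-namespace linter
set_option linter.dupNamespace false

namespace Summit.NavierStokesRegularity.NavierStokesRegularity.Theorems.Dou2026c

open Literature.Analysis.FluidPDE Literature.Analysis.FluidPDE.PolyFieldCert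
open Literature.Analysis.Calculus.MvPoly
open Literature.Claims.NS.Dou2026c
open Literature.Claims.NS.Dou2026b (e h1LocalSq)

/-- The Poiseuille components as polynomials: `(c (h² − X₁²), 0, 0)`, `c = G/(2ν)`. [folklore] -/
def poisPoly (ν G h : ℝ) : Fin 3 → MvPolynomial (Fin 3) ℝ :=
  ![MvPolynomial.C (G / (2 * ν)) * (MvPolynomial.C (h ^ 2) - MvPolynomial.X 1 ^ 2), 0, 0]

/-- The driving pressure as a polynomial: `−G X₀`. [folklore] -/
def pressPoly (G : ℝ) : MvPolynomial (Fin 3) ℝ := MvPolynomial.C (-G) * MvPolynomial.X 0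

/-- A derivation kills numerals. [folklore] -/
@[simp] theorem pderiv_ofNat (i : Fin 3) (n : ℕ) [n.AtLeastTwo] :
    MvPolynomial.pderiv i (OfNat.ofNat n : MvPolynomial (Fin 3) ℝ) = 0 := by
  have h : (OfNat.ofNat n : MvPolynomial (Fin 3) ℝ) = ((OfNat.ofNat n : ℕ) : MvPolynomial (Fin 3) ℝ) :=
    (Nat.cast_ofNat).symm
  rw [h]
  exact Derivation.map_natCast _ _

/-- `poiseuille = polyField poisPoly`. [folklore] -/
theorem poiseuille_eq_polyField (ν G h : ℝ) : poiseuille ν G h = polyField (poisPoly ν G h) := by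
  funext x
  ext i
  fin_cases i <;> simp [poiseuille, e, poisPoly, polyField_apply, toFun_apply]

/-- `drivingPressure G t = toFun pressPoly`. [folklore] -/
theorem drivingPressure_eq_toFun (G t : ℝ) : drivingPressure G t = toFun (pressPoly G) := by
  funext x
  simp [drivingPressure, pressPoly, toFun_apply]

/-- First partial derivatives of the Poiseuille component polynomial. [folklore] -/
theorem pderiv_poisPoly_zero (ν G h : ℝ) (j : Fin 3) (hj : j ≠ 1) :
    MvPolynomial.pderiv j (poisPoly ν G h 0) = 0 := by
  simp [poisPoly, Derivation.leibniz, Derivation.leibniz_pow, MvPolynomial.pderiv_X_of_ne hj.symm]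

/-- `∂₁ (c (h² − X₁²)) = −2c X₁`. [folklore] -/
theorem pderiv_one_poisPoly_zero (ν G h : ℝ) :
    MvPolynomial.pderiv 1 (poisPoly ν G h 0) =
      MvPolynomial.C (G / (2 * ν)) * (-(2 * MvPolynomial.X 1)) := by
  simp [poisPoly, Derivation.leibniz, Derivation.leibniz_pow]

/-- `(u·∇)u = 0` for the Poiseuille field (it depends on `y` only and points along `x`). [folklore] -/
theorem convect_poiseuille (ν G h : ℝ) (x : EuclideanSpace ℝ (Fin 3)) :
    convect (poiseuille ν G h) (poiseuille ν G h) x = 0 := by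
  rw [poiseuille_eq_polyField]
  ext i
  rw [convect_polyField_apply, Fin.sum_univ_three]
  fin_cases i
  · simp [polyField_apply, poisPoly]
  · simp [poisPoly]
  · simp [poisPoly]

/-- `Δ u = −(G/ν) e_x` for the Poiseuille field. [folklore] -/
theorem laplacian_poiseuille (ν G h : ℝ) (hν : ν ≠ 0) (x : EuclideanSpace ℝ (Fin 3)) :
    (Δ (poiseuille ν G h)) x = (-(G / ν)) • e 0 := by
  rw [poiseuille_eq_polyField]
  ext i
  rw [laplacian_polyField_apply, Fin.sum_univ_three]
  fin_cases i
  · have h2 : MvPolynomial.pderiv 1 (2 : MvPolynomial (Fin 3) ℝ) = 0 := pderiv_ofNat 1 2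
    simp [e, poisPoly, Derivation.leibniz, toFun_apply, h2]
    field_simp
  · simp [poisPoly, e]
  · simp [poisPoly, e]

/-- `∇p = −G e_x` for the driving pressure. [folklore] -/
theorem gradient_drivingPressure (G t : ℝ) (x : EuclideanSpace ℝ (Fin 3)) :
    gradient (drivingPressure G t) x = (-G) • e 0 := by
  rw [drivingPressure_eq_toFun]
  ext i
  rw [gradient_toFun_apply]
  fin_cases i <;> simp [pressPoly, e, Derivation.leibniz, toFun_apply]

/-- `div u = 0` for the Poiseuille field. [folklore] -/
theorem divergence_poiseuille (ν G h : ℝ) (x : EuclideanSpace ℝ (Fin 3)) :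
    VectorCalculus.divergence (poiseuille ν G h) x = 0 := by
  rw [poiseuille_eq_polyField, divergence_polyField, Fin.sum_univ_three]
  simp [poisPoly]

/-- The Poiseuille field is smooth. [folklore] -/
theorem contDiff_poiseuille (ν G h : ℝ) : ContDiff ℝ ∞ (poiseuille ν G h) := by
  rw [poiseuille_eq_polyField]; exact contDiff_polyField _

/-- **Step 0 holds: the steady Poiseuille flow with the driving pressure `−Gx` is a solution of the
typed channel problem on every time set** (§2.1 PDF p.5). [cite: Dou2026c, §2.1 PDF p.5 l.8–11] -/
theorem poiseuille_isChannelSolution : Step0_baseFlow := by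
  intro S ν G h hν
  refine ⟨?_, ?_, ?_, ?_, ?_, ?_, ?_⟩
  · exact ((contDiff_poiseuille ν G h).comp contDiff_snd).contDiffOn
  · have : ContDiff ℝ ∞ (Function.uncurry (drivingPressure G)) := by
      have h0 : ContDiff ℝ ∞ (fun z : ℝ × EuclideanSpace ℝ (Fin 3) => z.2 0) :=
        (EuclideanSpace.proj (0 : Fin 3) : EuclideanSpace ℝ (Fin 3) →L[ℝ] ℝ).contDiff.comp contDiff_snd
      exact contDiff_const.mul h0
    exact this.contDiffOn
  · intro t _ x _
    have hνG : ν * -(G / ν) = -G := by field_simp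
    rw [timeDerivWithin, derivWithin_fun_const, convect_poiseuille, laplacian_poiseuille ν G h hν.ne',
      gradient_drivingPressure, smul_smul, hνG]
    simp
  · intro t _ x _
    exact divergence_poiseuille ν G h x
  · intro t _ x hx
    rcases hx with hx | hx <;> simp [poiseuille, hx]
  · intro t _
    exact ⟨0, fun x _ => by simp [drivingPressure]⟩
  · intro t _
    refine ⟨|G / (2 * ν)| * h ^ 2, fun x hx => ?_⟩
    have he : ‖(e 0 : EuclideanSpace ℝ (Fin 3))‖ = 1 := by simp [e]
    have h1 : 0 < h ^ 2 - (x 1) ^ 2 := by nlinarith [hx.1, hx.2]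
    rw [poiseuille, norm_smul, he, mul_one, Real.norm_eq_abs, abs_mul, abs_of_pos h1]
    exact mul_le_mul_of_nonneg_left (by nlinarith [sq_nonneg (x 1)]) (abs_nonneg _)

/-- The zero disturbance is admissible (smooth, divergence free, zero on the walls, and pointwise
smaller than the base flow in the open slab since `(G/2ν)(h² − y²) > 0` there).
[cite: Dou2026c, §2.1 PDF p.5 l.8–17] -/
theorem zero_admissible {ν G h : ℝ} (hν : 0 < ν) (hG : 0 < G) :
    IsAdmissibleDisturbance ν G h (fun _ => 0) := by
  refine ⟨contDiff_const, fun x _ => ?_, fun _ _ => rfl, fun x hx => ?_⟩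
  · rw [show (fun _ : EuclideanSpace ℝ (Fin 3) => (0 : EuclideanSpace ℝ (Fin 3))) =
        fun _ => (0 : EuclideanSpace ℝ (Fin 3)) from rfl]
    simp [VectorCalculus.divergence]
  · have h1 : 0 < h ^ 2 - (x 1) ^ 2 := by
      have : (x 1) ^ 2 < h ^ 2 := by nlinarith [hx.1, hx.2]
      linarith
    have hc : 0 < G / (2 * ν) * (h ^ 2 - (x 1) ^ 2) := by positivity
    rw [norm_zero, poiseuille, norm_smul, Real.norm_eq_abs, abs_of_pos hc]
    have he : ‖(e 0 : EuclideanSpace ℝ (Fin 3))‖ = 1 := by simp [e]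
    rw [he, mul_one]
    exact hc

/-- The local H¹-energy of the CONSTANT field `Δu = −(G/ν) e_x` on any ball is the positive constant
`(G/ν)² · |B_ε|`. [folklore] -/
theorem h1LocalSq_const (v c : EuclideanSpace ℝ (Fin 3)) (ε : ℝ) :
    h1LocalSq (fun _ => v) c ε = ‖v‖ ^ 2 * (volume (Metric.ball c ε)).toReal := by
  rw [h1LocalSq]
  have : (fun x : EuclideanSpace ℝ (Fin 3) =>
      ‖v‖ ^ 2 + ‖fderiv ℝ (fun _ : EuclideanSpace ℝ (Fin 3) => v) x‖ ^ 2) = fun _ => ‖v‖ ^ 2 := by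
    funext x; simp
  rw [this, setIntegral_const, smul_eq_mul, mul_comm]
  rfl

/-- **Step 1 (the vanishing point (20), PDF p.12) is false for the base flow**: with `v₀ = 0` the
solution is the steady Poiseuille flow, whose `Δu ≡ −(G/ν) e_x` has local H¹-energy a positive
constant on every ball, so it cannot tend to `0`. Witness parameters `ν = h = 1`, `G = 2(|Recr| + 1)`.
[cite: Dou2026c, §4.2 Step 1 (2)–(3), eq. (20) PDF p.12] -/
theorem not_Step1_vanishingPoint (Recr : ℝ) : ¬ Step1_vanishingPoint Recr := by
  intro h1
  set G : ℝ := 2 * (|Recr| + 1) with hG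
  have hGpos : 0 < G := by rw [hG]; positivity
  have hRe : Recr < reynoldsP 1 G 1 := by
    rw [reynoldsP, hG]; norm_num; linarith [le_abs_self Recr]
  have hsol := poiseuille_isChannelSolution (Ici 0) 1 G 1 one_pos
  obtain ⟨ts, hts, xs, hxs, ε, hε, _, _, hlim⟩ :=
    h1 1 G 1 (fun _ => 0) (fun _ => poiseuille 1 G 1) (drivingPressure G) one_pos hGpos one_pos
      (zero_admissible one_pos hGpos) hRe hsol (fun x _ => by simp)
  have hconst : (fun t : ℝ => h1LocalSq (Δ ((fun _ : ℝ => poiseuille 1 G 1) t)) xs ε) =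
      fun _ => ‖(-(G / 1)) • (e 0 : EuclideanSpace ℝ (Fin 3))‖ ^ 2 * (volume (Metric.ball xs ε)).toReal := by
    funext t
    have hΔ : (Δ (poiseuille 1 G 1)) = fun _ => (-(G / 1)) • (e 0 : EuclideanSpace ℝ (Fin 3)) :=
      funext fun x => laplacian_poiseuille 1 G 1 one_ne_zero x
    rw [hΔ, h1LocalSq_const]
  rw [hconst] at hlim
  have hval := tendsto_nhds_unique hlim tendsto_const_nhds
  have hvol : 0 < (volume (Metric.ball xs ε)).toReal :=
    ENNReal.toReal_pos (Metric.measure_ball_pos volume xs hε).ne' measure_ball_lt_top.ne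
  have hnorm : 0 < ‖(-(G / 1)) • (e 0 : EuclideanSpace ℝ (Fin 3))‖ ^ 2 := by
    have : ‖(-(G / 1)) • (e 0 : EuclideanSpace ℝ (Fin 3))‖ = G := by
      rw [norm_smul, Real.norm_eq_abs]; simp [e, abs_of_pos hGpos]
    rw [this]; positivity
  have : 0 < ‖(-(G / 1)) • (e 0 : EuclideanSpace ℝ (Fin 3))‖ ^ 2 * (volume (Metric.ball xs ε)).toReal :=
    mul_pos hnorm hvol
  linarith

/-- **Theorem 4.1's operative clause is false as printed/typed**: for `ν = h = 1`, `G = 2(|Recr|+1)`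
(`Re = G/2 > Recr`) and the admissible disturbance `v₀ = 0`, the steady Poiseuille flow is a global
smooth solution of the channel problem. [cite: Dou2026c, Theorem 4.1 PDF p.10 l.37–51] -/
theorem not_ClaimedTheorem_baseFlow (Recr : ℝ) : ¬ ClaimedTheorem Recr := by
  intro hC
  set G : ℝ := 2 * (|Recr| + 1) with hG
  have hGpos : 0 < G := by rw [hG]; positivity
  have hRe : Recr < reynoldsP 1 G 1 := by
    rw [reynoldsP, hG]; norm_num; linarith [le_abs_self Recr]
  exact hC 1 G 1 (fun _ => 0) one_pos hGpos one_pos (zero_admissible one_pos hGpos) hRe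
    ⟨fun _ => poiseuille 1 G 1, drivingPressure G, poiseuille_isChannelSolution (Ici 0) 1 G 1 one_pos,
      fun x _ => by simp⟩

/-- Hence also the existential reading fails. [cite: Dou2026c, Theorem 4.1 PDF p.10] -/
theorem not_ClaimedTheoremE : ¬ ClaimedTheoremE := fun ⟨R, h⟩ => not_ClaimedTheorem_baseFlow R h

end Summit.NavierStokesRegularity.NavierStokesRegularity.Theorems.Dou2026c

end

-- WHAT THIS IS NOT: not a claim about NS regularity or blow-up; not a claim about any author beyond the typed locator.
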